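import Summits.FinalStateConjecture.FinalStateConjecture.Theorems.ClusterCompletenessOmegaLimitMultiKerrDefs
import Literature.Geometry.Lorentzian.EventHorizonArea
import Literature.Geometry.Lorentzian.CutBondiMass
import HarnessLib

/-!
# Route ClusterCompleteness · crux `LinearToNonlinearCapture` — posited objects of line
# `two-pins-and-completeness` (D-0016 `<Route>Defs` convention)

This file carries no mathematics beyond six definitions and one definitional read-back lemma. It is
the STABLE vocabulary over which the registered stubs of line `two-pins-and-completeness` of the crux
stmt-FinalStateConjecture-14526 (`ClusterCompleteness.LinearToNonlinearCapture :=
AdiabaticMultiKerrILED → RecurrentMultiKerrCapture`, rank 3) are stated, moved VERBATIM out of the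
crux workfile `Cruxes/LinearToNonlinearCapture/Lines/two_pins_and_completeness.lean` §0 (planner
`planner-cruxplan-stmt-FinalStateConjecture-14526-two-pins-and-complet-0`, 2026-08-16; the line card's
first definition request) so that stub proofs (`Theorems/…`, `--supports stmt-FinalStateConjecture-14526`)
and the skeleton import ONE copy:

* `ChartBlock 𝒟 O M a mo τ₀ Ψ ρ R U₀ Ψ₀` — the STRUCTURAL clauses of the hypothesis of the route
  target X (`RecurrentMultiKerrCapture`) for one chart system: verbatim the first nine conjuncts of
  the matrix `Recurs` (`ClusterCompletenessOmegaLimitMultiKerrDefs`), charts as parameters;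
* `RecurAt k 𝒟 M a mo τ₀ Ψ R U₀ Ψ₀` — the CLOSENESS clauses (uniform `C⁰` anchor + recurring `Cᵏ`
  `ε`-closeness): verbatim the last two conjuncts of `Recurs k`; read-back
  `recurs_iff_chartBlock_recurAt : Recurs k 𝒟 ↔ ∃ charts, ChartBlock ∧ RecurAt k` (re-bracketing);
* `PinnedExits 𝒟 M a mo τ₀ Ψ R U₀ Ψ₀` — the line's hypothesis-side waypoint: a chart-time-synchronised
  advanced-time foliation of the event horizon of the charted set (`EventHorizonArea`) with section
  areas increasing to a FINITE limit, and Bondi energies of the late cuts (`HasCutBondiMass`,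
  `cutBondiMass`) converging from above;
* `OrbitCharts 𝒟 M a mo τ₀ Ψ η` — the conclusion-side waypoint: re-chosen charts with the same labels,
  inner near zones inside the original hole charts' images, `C²` deviation `≤ η` at ALL late times;
* `ConvCharts 𝒟 M a mo` — re-chosen charts with `ChartBlock` and `C²` CONVERGENCE (verbatim the
  hypotheses of the landed glue `stub_settlesOfConverges`, p105343);
* `ScalarRateFreeDecay` — the MODEL statement where the engine `AdiabaticMultiKerrILED` is consumed:
  same quantifier prefix, coefficient field `G` and energy functional `E` as the engine (copied
  verbatim from the route file), conclusion = rate-free decay of the local energy of every smooth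
  finite-energy solution.

Everything is a definition over EXISTING declarations (`VacuumCauchyDevelopment`, `Spacetime.IsLateChart /
deviationCk / truncDeviationCk`, `boostedKerrExterior / boostedKerrBackground`, `Minkowski.backgroundOn`,
`Summit.FinalStateConjecture.exteriorOf`, `EventHorizonArea`, `CauchyDevelopment.eventHorizon /
HasCutBondiMass / cutBondiMass`, `Kerr.radius / scalarH / nullVector / rPlus`, `poincareInv`,
`Real.smoothTransition`); nothing restates a route item under a new name (`ChartBlock ∧ RecurAt` is the
re-bracketed matrix of X's hypothesis, certified by `recurs_iff_chartBlock_recurAt`; `ScalarRateFreeDecay`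
shares the engine's prefix but concludes pointwise-in-time local energy decay, which the engine does not
state). This module does not import the route file. DEDUP NOTE: the six definitions are verbatim copies of
`Cruxes/LinearToNonlinearCapture/Lines/two_pins_and_completeness.lean` §0 (a crux WORKFILE, not importable
from `Theorems/`); once this module lands the skeleton imports it and drops its copies (registered stub
signatures unchanged textually).
-/

-- every `Summit.FinalStateConjecture.FinalStateConjecture.…` name repeats the summit = sub-problem segment (D-0017 layout)
set_option linter.dupNamespace false

noncomputable section

open scoped BigOperators Topology Manifold ENNReal ContDiff InnerProductSpace RealInnerProductSpace
open Filter Set Function TopologicalSpace MeasureTheory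

namespace Summit.FinalStateConjecture.FinalStateConjecture.Theorems.ClusterCompleteness

open Literature.Geometry.Lorentzian

section Defs

variable {X : Type} [TopologicalSpace X] [ChartedSpace E3 X] [IsManifold (𝓡 3) ∞ X]
  [ConnectedSpace X] {D : InitialDataSet (𝓡 3) X}

/-- **Structural chart clauses** of the hypothesis of `RecurrentMultiKerrCapture` for ONE chart
system on the maximal development `𝒟` with `N` holes: sub-extremal labels `(Mᵢ, aᵢ)`, hole charts
`Ψᵢ` (on the boosted Kerr EXTERIORS `{rᵢ > r₊}`, exterior-only as in X) and a flat chart `Ψ₀`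
which are late charts into `O` after `τ₀`, sublinear excision radii `ρᵢ`, exhaustion radii
`Rᵢ → ∞`, flat domain `U₀ ⊇ {x⁰ > τ₀} ∖ tubes`, separation of the holes for every radius,
`O = exteriorOf(charted)`, and exhaustion of `O` by the certified regions for every `τ₁ > τ₀` —
verbatim the first nine conjuncts of the matrix `Recurs` (route `ClusterCompleteness`, rev 16
interface), with the charts as parameters. [cite: DafermosLuk2017, §1.2.1] -/
def ChartBlock (𝒟 : VacuumCauchyDevelopment D) {N : ℕ} (O : Set 𝒟.carrier) (M a : Fin N → ℝ)
    (mo : Fin N → lorentzGroup × E4) (τ₀ : ℝ)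
    (Ψ : ∀ i, boostedKerrExterior (mo i).1 (mo i).2 (M i) (a i) → 𝒟.carrier)
    (ρ R : Fin N → ℝ → ℝ) (U₀ : Opens E4) (Ψ₀ : U₀ → 𝒟.carrier) : Prop :=
  (∀ i, Kerr.IsSubextremal (M i) (a i)) ∧
  (∀ i, 𝒟.toSpacetime.IsLateChart (boostedKerrBackground (mo i).1 (mo i).2 (M i) (a i)) O τ₀
    (Ψ i)) ∧
  𝒟.toSpacetime.IsLateChart (Minkowski.backgroundOn U₀) O τ₀ Ψ₀ ∧
  (∀ i, Tendsto (fun t ↦ ρ i t / t) atTop (𝓝 0)) ∧ (∀ i, Tendsto (R i) atTop atTop) ∧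
  {x : E4 | τ₀ < x 0 ∧ ∀ i, ρ i (x 0) <
    Kerr.radius (a i) (poincareInv (mo i).1 (mo i).2 x)} ⊆ (U₀ : Set E4) ∧
  (∀ R' : ℝ, ∃ τ₁ : ℝ, Pairwise (Function.onFun Disjoint fun i ↦ Ψ i ''
    (boostedKerrBackground (mo i).1 (mo i).2 (M i) (a i)).truncLateRegion τ₁ R')) ∧
  O = Summit.FinalStateConjecture.exteriorOf 𝒟.toCauchyDevelopment
    ((⋃ i, Ψ i '' (boostedKerrBackground (mo i).1 (mo i).2 (M i) (a i)).lateRegion τ₀) ∪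
      Ψ₀ '' (Minkowski.backgroundOn U₀).lateRegion τ₀) ∧
  (∀ τ₁ : ℝ, τ₀ < τ₁ → O \ (Ψ₀ '' (Minkowski.backgroundOn U₀).lateRegion τ₁ ∪
    ⋃ i, Ψ i '' {x | τ₁ < (boostedKerrBackground (mo i).1 (mo i).2 (M i) (a i)).time x.1 ∧
      (boostedKerrBackground (mo i).1 (mo i).2 (M i) (a i)).radius x.1 ≤
        R i ((boostedKerrBackground (mo i).1 (mo i).2 (M i) (a i)).time x.1)}) ⊆
    𝒟.metric.causalPast 𝒟.timeOrientation (Ψ₀ '' (Minkowski.backgroundOn U₀).timeSlab τ₁ ∪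
      ⋃ i, Ψ i '' (boostedKerrBackground (mo i).1 (mo i).2 (M i) (a i)).truncTimeSlab
        (R i τ₁) τ₁))

/-- **Closeness clauses** of X's hypothesis at order `k` for one chart system: the uniform `C⁰`
ANCHOR (deviation `≤ 1/4` on every flat slab and every certified near-zone slab at all chart
times `τ > τ₀`) and RECURRENCE (`Cᵏ` `ε`-closeness, `∃ᶠ τ`, for every `ε > 0` and every
near-zone radius `R'`) — verbatim the last two conjuncts of `Recurs k`. [cite: DafermosLuk2017, §1.2.1] -/
def RecurAt (k : ℕ) (𝒟 : VacuumCauchyDevelopment D) {N : ℕ} (M a : Fin N → ℝ)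
    (mo : Fin N → lorentzGroup × E4) (τ₀ : ℝ)
    (Ψ : ∀ i, boostedKerrExterior (mo i).1 (mo i).2 (M i) (a i) → 𝒟.carrier)
    (R : Fin N → ℝ → ℝ) (U₀ : Opens E4) (Ψ₀ : U₀ → 𝒟.carrier) : Prop :=
  (∀ τ : ℝ, τ₀ < τ →
    𝒟.toSpacetime.deviationCk (Minkowski.backgroundOn U₀) Ψ₀ 0 τ ≤ ENNReal.ofReal (1 / 4) ∧
    ∀ i, 𝒟.toSpacetime.truncDeviationCk (boostedKerrBackground (mo i).1 (mo i).2 (M i) (a i))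
      (Ψ i) 0 (R i τ) τ ≤ ENNReal.ofReal (1 / 4)) ∧
  ∀ R' : ℝ, ∀ ε : ℝ, 0 < ε → ∃ᶠ τ in atTop,
    𝒟.toSpacetime.deviationCk (Minkowski.backgroundOn U₀) Ψ₀ k τ ≤ ENNReal.ofReal ε ∧
    ∀ i, 𝒟.toSpacetime.truncDeviationCk (boostedKerrBackground (mo i).1 (mo i).2 (M i) (a i))
      (Ψ i) k R' τ ≤ ENNReal.ofReal ε

/-- **Pinned exits** of the chart system (the lever's hypothesis-side waypoint, NOT stated by X).
(H) HORIZON EXIT: the event horizon `𝓗⁺ = ∂I⁻(charted) ∩ J⁺(ιX)` of the charted late set carries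
an advanced-time foliation `H : EventHorizonArea` (`EventHorizonArea.lean`: achronal spacelike
slicing hypersurfaces with compact, causally ordered sections covering `𝓗⁺`) SYNCHRONISED with
chart time in the weakest useful sense — every FIXED cut is eventually (in the chart time `v`)
disjoint from the chronological future of the certified near-zone slabs at time `v`, so the
horizon to the future of a late leaf only meets late cuts — whose section areas are bounded by
and converge to a FINITE value `A∞` (the area still to be gained after chart time `v` tends to
`0`; expected `A∞ = Σᵢ 8πMᵢr₊(Mᵢ,aᵢ)`, not asserted). Empty horizon: vacuous with `A∞ = 0`.
(B) NULL-INFINITY EXIT: for every late chart time `τ` the cut of `𝓘⁺` generated by the certified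
near-zone slabs `K_τ = ⋃ᵢ Ψᵢ({t*ᵢ = τ, r₊ < rᵢ ≤ Rᵢ(τ)})` has a Bondi energy in some asymptotic
frame (`HasCutBondiMass`: a round receding family on `∂J⁺(K_τ)` with convergent Hawking masses —
Christodoulou–Klainerman Ch. 17 intrinsic form, no conformal boundary), and the rest masses
`cutBondiMass (K_τ)` converge FROM ABOVE to a final value `μ` (radiated rest-mass budget after `τ`
tends to `0`; lower bound = reverse triangle inequality for the causal Bondi momentum loss, so no
causal ordering of the cuts is presupposed). [cite: ChruscielEtAl2001, Thm. 1.1]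
[cite: ChristodoulouKlainerman1993PMS41, Ch. 17, Conclusion 17.0.4] -/
def PinnedExits (𝒟 : VacuumCauchyDevelopment D) {N : ℕ} (M a : Fin N → ℝ)
    (mo : Fin N → lorentzGroup × E4) (τ₀ : ℝ)
    (Ψ : ∀ i, boostedKerrExterior (mo i).1 (mo i).2 (M i) (a i) → 𝒟.carrier)
    (R : Fin N → ℝ → ℝ) (U₀ : Opens E4) (Ψ₀ : U₀ → 𝒟.carrier) : Prop :=
  let C : Set 𝒟.carrier :=
    (⋃ i, Ψ i '' (boostedKerrBackground (mo i).1 (mo i).2 (M i) (a i)).lateRegion τ₀) ∪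
      Ψ₀ '' (Minkowski.backgroundOn U₀).lateRegion τ₀
  let K : ℝ → Set 𝒟.carrier := fun τ ↦
    ⋃ i, Ψ i '' (boostedKerrBackground (mo i).1 (mo i).2 (M i) (a i)).truncTimeSlab (R i τ) τ
  (∃ (H : EventHorizonArea 𝒟.toCauchyDevelopment C) (A : ℝ≥0∞), A ≠ ⊤ ∧
    (∀ w : ℝ, ∀ᶠ v in atTop, ∀ i, Disjoint
      (Set.range (H.leaf w) ∩ 𝒟.toCauchyDevelopment.eventHorizon C)
      (𝒟.metric.chronologicalFuture 𝒟.timeOrientation (Ψ i ''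
        (boostedKerrBackground (mo i).1 (mo i).2 (M i) (a i)).truncTimeSlab (R i v) v))) ∧
    (∀ v, H.horizonArea v ≤ A) ∧ Tendsto H.horizonArea atTop (𝓝 A)) ∧
  (∀ τ : ℝ, τ₀ < τ → ∃ m : ℝ, 𝒟.toCauchyDevelopment.HasCutBondiMass (K τ) m) ∧
  ∃ μ : ℝ, (∀ τ : ℝ, τ₀ < τ → μ ≤ 𝒟.toCauchyDevelopment.cutBondiMass (K τ)) ∧
    Tendsto (fun τ ↦ 𝒟.toCauchyDevelopment.cutBondiMass (K τ)) atTop (𝓝 μ)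

/-- **Orbital capture at scale `η`** (the lever's conclusion-side waypoint): there are RE-CHOSEN
charts with the SAME labels `(N, Mᵢ, aᵢ, Λᵢ, cᵢ)` — a later start `τ₀'`, hole charts `Ψ'ᵢ`, flat
chart `Ψ₀'` on `U₀'`, radii `ρ'`, `R'`, exterior `O'` — satisfying `ChartBlock`, whose inner near
zones `{t*ᵢ = τ, r₊ < rᵢ ≤ 16Mᵢ}` lie inside the ORIGINAL hole chart `Ψᵢ`'s late image (they
chart the same physical holes), and in which the `C²` deviation is at most `η` at EVERY chart time
`τ > τ₀'`: on whole flat slabs, and on the near zones out to `R'ᵢ(τ) → ∞`. (Order `2` =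
the Statement's; all derivative loss from the recurrence order `k` happens before this point.)
[cite: arXiv210408222, §1] -/
def OrbitCharts (𝒟 : VacuumCauchyDevelopment D) {N : ℕ} (M a : Fin N → ℝ)
    (mo : Fin N → lorentzGroup × E4) (τ₀ : ℝ)
    (Ψ : ∀ i, boostedKerrExterior (mo i).1 (mo i).2 (M i) (a i) → 𝒟.carrier) (η : ℝ) : Prop :=
  ∃ (O' : Set 𝒟.carrier) (τ₀' : ℝ)
    (Ψ' : ∀ i, boostedKerrExterior (mo i).1 (mo i).2 (M i) (a i) → 𝒟.carrier)
    (ρ' R' : Fin N → ℝ → ℝ) (U₀' : Opens E4) (Ψ₀' : U₀' → 𝒟.carrier),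
    ChartBlock 𝒟 O' M a mo τ₀' Ψ' ρ' R' U₀' Ψ₀' ∧
    (∀ i, ∀ τ : ℝ, τ₀' < τ →
      Ψ' i '' (boostedKerrBackground (mo i).1 (mo i).2 (M i) (a i)).truncTimeSlab (16 * M i) τ ⊆
        Ψ i '' (boostedKerrBackground (mo i).1 (mo i).2 (M i) (a i)).lateRegion τ₀) ∧
    ∀ τ : ℝ, τ₀' < τ →
      𝒟.toSpacetime.deviationCk (Minkowski.backgroundOn U₀') Ψ₀' 2 τ ≤ ENNReal.ofReal η ∧
      ∀ i, 𝒟.toSpacetime.truncDeviationCk (boostedKerrBackground (mo i).1 (mo i).2 (M i) (a i))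
        (Ψ' i) 2 (R' i τ) τ ≤ ENNReal.ofReal η

/-- **Convergent charts**: re-chosen charts with the same labels satisfying `ChartBlock` in which
the `C²` deviations CONVERGE to `0` (flat: whole slabs; holes: out to `R'ᵢ(τ)`) — verbatim the
hypotheses of the landed glue `stub_settlesOfConverges` (p105343), which turns them into the
Statement's settling conjunct. [cite: arXiv210408222, §1] -/
def ConvCharts (𝒟 : VacuumCauchyDevelopment D) {N : ℕ} (M a : Fin N → ℝ)
    (mo : Fin N → lorentzGroup × E4) : Prop :=
  ∃ (O' : Set 𝒟.carrier) (τ₀' : ℝ)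
    (Ψ' : ∀ i, boostedKerrExterior (mo i).1 (mo i).2 (M i) (a i) → 𝒟.carrier)
    (ρ' R' : Fin N → ℝ → ℝ) (U₀' : Opens E4) (Ψ₀' : U₀' → 𝒟.carrier),
    ChartBlock 𝒟 O' M a mo τ₀' Ψ' ρ' R' U₀' Ψ₀' ∧
    Tendsto (fun τ ↦ 𝒟.toSpacetime.deviationCk (Minkowski.backgroundOn U₀') Ψ₀' 2 τ)
      atTop (𝓝 0) ∧
    ∀ i, Tendsto (fun τ ↦ 𝒟.toSpacetime.truncDeviationCk
      (boostedKerrBackground (mo i).1 (mo i).2 (M i) (a i)) (Ψ' i) 2 (R' i τ) τ) atTop (𝓝 0)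

end Defs

/-- **Rate-free local energy decay on the engine's background** (MODEL statement; the typed point
where `AdiabaticMultiKerrILED` is consumed). Same quantifier prefix, background coefficient field
`G` (N boosted sub-extremal Kerr near zones in flat space, tails cut by the fixed gentle step,
`|aᵢ| ≤ αMᵢ`, speeds `≤ v₀`, pairwise STRICT recession, separations `≥ d₀(Mᵢ + Mⱼ)`) and energy
functional `E` as `AdiabaticMultiKerrILED` — copied VERBATIM — and then: for every radius `R` and
every smooth `ψ` solving the divergence-form equation on `{x⁰ ≥ 0}` outside the horizons with
`E ψ 0 < ∞` and `E (∂₀ψ) 0 < ∞`, the local energy `∫_{‖y‖ ≤ R, outside all horizons} Σ_μ(∂_μψ)²`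
at lab time `t` tends to `0` as `t → ∞` (the integrand of (b) of the engine, pointwise in time
instead of `L¹`; NO rate). A POSITED statement of this line (the registered stub
`stub_scalarRateFreeDecay : AdiabaticMultiKerrILED → ScalarRateFreeDecay` derives it from the
engine), not a published result: intended proof = domain-of-dependence energy estimate on the
patched background, uniform in the base time (the local form of `stub_finiteTimeEnergy`: energy in
`{‖y‖ ≤ R}` at lab time `t` is at most `K ×` the energy in `{‖y‖ ≤ R + 2}` at any lab time
`s ∈ [t − 1, t]`) + time-integrability of the local energy from (b) of the engine ⇒ a Barbalat-type
lemma; mechanism as in Dafermos–Rodnianski arXiv:0811.0354 §3–§4 (energy estimates outside a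
future horizon) and, for the massless cure of bound states, Chodosh–Shlapentokh-Rothman CMP 356
(2017) Thm 1.2. Void, like the engine, for configurations with a non-receding pair (`Δv = 0`).
[conjecture] [folklore] -/
def ScalarRateFreeDecay : Prop :=
  ∀ N : ℕ, ∃ d₀ α v₀ : ℝ, 0 < d₀ ∧ 0 < α ∧ 0 < v₀ ∧ ∀ (M a : Fin N → ℝ) (Λ : Fin N → lorentzGroup)
    (p : Fin N → E3) (u : Fin N → E4) (q : Fin N → E4 → E4), (∀ i, u i = (Λ i : E4 ≃L[ℝ] E4)
    (E4.basisVector 0)) → (∀ i x, q i x = poincareInv (Λ i) (E4.ofTimeSpace 0 (p i)) x) → (∀ i, 0 <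
    M i) → (∀ i, |a i| ≤ α * M i) → (∀ i, 0 < u i 0 ∧ ‖E4.spatial (u i)‖ ≤ v₀ * u i 0) → (∀ i j, i ≠
    j → d₀ * (M i + M j) ≤ dist (p i) (p j) ∧ 0 < ⟪p i - p j, (u i 0)⁻¹ • E4.spatial (u i) - (u j
    0)⁻¹ • E4.spatial (u j)⟫_ℝ) → ∀ (G : E4 → Fin 4 → Fin 4 → ℝ), (∀ x μ ν, G x μ ν =
    Minkowski.bilin (E4.basisVector μ) (E4.basisVector ν) - ∑ i, Real.smoothTransition (2 -
    Kerr.radius (a i) (q i x) / (8 * M i)) * (2 * Kerr.scalarH (M i) (a i) (q i x)) * ((Λ i : E4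
    ≃L[ℝ] E4) (Kerr.nullVector (a i) (q i x))) μ * ((Λ i : E4 ≃L[ℝ] E4) (Kerr.nullVector (a i) (q i
    x))) ν) → ∀ (E : (E4 → ℝ) → ℝ → ENNReal), (∀ φ t, E φ t = ∫⁻ y in {y : E3 | ∀ i, Kerr.rPlus (M
    i) (a i) < Kerr.radius (a i) (q i (E4.ofTimeSpace t y))}, ENNReal.ofReal (∑ μ : Fin 4, (fderiv ℝ
    φ (E4.ofTimeSpace t y) (E4.basisVector μ)) ^ 2)) → ∀ R : ℝ, ∀ ψ : E4 → ℝ, ContDiff ℝ ∞ ψ → (∀ x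
    : E4, 0 ≤ x 0 → (∀ i, Kerr.rPlus (M i) (a i) < Kerr.radius (a i) (q i x)) → ∑ μ : Fin 4, fderiv
    ℝ (fun y ↦ ∑ ν : Fin 4, G y μ ν * fderiv ℝ ψ y (E4.basisVector ν)) x (E4.basisVector μ) = 0) → E
    ψ 0 ≠ ⊤ → E (fun x ↦ fderiv ℝ ψ x (E4.basisVector 0)) 0 ≠ ⊤ → Tendsto (fun t : ℝ ↦ ∫⁻ y in {y :
    E3 | ‖y‖ ≤ R ∧ ∀ i, Kerr.rPlus (M i) (a i) < Kerr.radius (a i) (q i (E4.ofTimeSpace t y))},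
    ENNReal.ofReal (∑ μ : Fin 4, (fderiv ℝ ψ (E4.ofTimeSpace t y) (E4.basisVector μ)) ^ 2)) atTop (𝓝
    0)

/-! ## Read-back (definitional): the posited vocabulary is X's hypothesis, re-bracketed -/

section ReadBack

variable {X : Type} [TopologicalSpace X] [ChartedSpace E3 X] [IsManifold (𝓡 3) ∞ X]
  [ConnectedSpace X] {D : InitialDataSet (𝓡 3) X}

/-- `Recurs k 𝒟` (the matrix of X's hypothesis, `ClusterCompletenessOmegaLimitMultiKerrDefs`) is
EXACTLY "some chart system satisfies `ChartBlock` and `RecurAt k`". -/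
theorem recurs_iff_chartBlock_recurAt (k : ℕ) (𝒟 : VacuumCauchyDevelopment D) :
    Recurs k 𝒟 ↔ ∃ (O : Set 𝒟.carrier) (N : ℕ) (M a : Fin N → ℝ) (mo : Fin N → lorentzGroup × E4)
      (τ₀ : ℝ) (Ψ : ∀ i, boostedKerrExterior (mo i).1 (mo i).2 (M i) (a i) → 𝒟.carrier)
      (ρ R : Fin N → ℝ → ℝ) (U₀ : Opens E4) (Ψ₀ : U₀ → 𝒟.carrier),
      ChartBlock 𝒟 O M a mo τ₀ Ψ ρ R U₀ Ψ₀ ∧ RecurAt k 𝒟 M a mo τ₀ Ψ R U₀ Ψ₀ := by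
  constructor
  · rintro ⟨O, N, M, a, mo, τ₀, Ψ, ρ, R, U₀, Ψ₀, h₁, h₂, h₃, h₄, h₅, h₆, h₇, h₈, h₉, h₁₀, h₁₁⟩
    exact ⟨O, N, M, a, mo, τ₀, Ψ, ρ, R, U₀, Ψ₀, ⟨h₁, h₂, h₃, h₄, h₅, h₆, h₇, h₈, h₉⟩, h₁₀, h₁₁⟩
  · rintro ⟨O, N, M, a, mo, τ₀, Ψ, ρ, R, U₀, Ψ₀, ⟨h₁, h₂, h₃, h₄, h₅, h₆, h₇, h₈, h₉⟩, h₁₀, h₁₁⟩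
    exact ⟨O, N, M, a, mo, τ₀, Ψ, ρ, R, U₀, Ψ₀, h₁, h₂, h₃, h₄, h₅, h₆, h₇, h₈, h₉, h₁₀, h₁₁⟩

end ReadBack

/-! ## Reshape 1 (lead a1, cycle 1, 2026-08-16): corrected pinned exits

The stub worker's audit of the registered S2 (`work/stubs/stub_pinnedExits.findings.md`, attached to
the crux item) showed that clause (B) of `PinnedExits` — Bondi energies of the cuts of `𝓘⁺` generated
by the UNION over the holes of the certified near-zone slabs `K τ = ⋃ᵢ Ψᵢ '' truncTimeSlabᵢ (Rᵢ τ) τ`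
— is false in every intended model: for `N ≥ 2` strictly receding holes the slabs are eventually
causally unrelated, the cone `∂J⁺(K τ)` is creased up to `𝓘⁺` and carries NO round receding section
family (tree precedent: `not_hasCutBondiMass_kissingBalls`, `KissingBallsCutMass.lean`), so (B1)
fails; for `N = 1` the radii `Rᵢ` are free in X's hypothesis (only `Rᵢ → ∞`), and fast-growing
honest radii move the cuts to EARLIER retarded times, so "bounded below by and converging to `μ`"
forces zero news on an interval; and `Rᵢ τ ≤ r₊ᵢ` at one late time makes `K τ = ∅`
(`¬ HasCutBondiMass ∅ m`). The corrected predicate keeps clause (H) verbatim and takes clause (B)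
over ONE causally coherent cut per chart time: the FLAT chart's ball slab
`K₀ τ = Ψ₀ '' {x ∈ U₀ | x⁰ = τ, |x̲| ≤ S τ}` with a cut radius `S` chosen by the prover, receding
(`S → ∞`) but subluminally (`τ − S τ → ∞`, so the cuts move to later retarded times and "from
above" is mass loss). The registered stubs S2/S3a of the line now use `PinnedExitsFlatCut`;
`PinnedExits` stays (append-only file) as the record of the refuted design. -/

section Reshape1

variable {X : Type} [TopologicalSpace X] [ChartedSpace E3 X] [IsManifold (𝓡 3) ∞ X]
  [ConnectedSpace X] {D : InitialDataSet (𝓡 3) X}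

/-- **Pinned exits with flat-chart cuts** (reshape 1 of the line's hypothesis-side waypoint).
(H) HORIZON EXIT — verbatim as in `PinnedExits`: an advanced-time foliation
`H : EventHorizonArea` of the event horizon of the charted late set, synchronised with chart time
(every fixed cut eventually outside the chronological future of the certified near-zone slabs),
with section areas bounded by and converging to a FINITE `A∞`.
(B) NULL-INFINITY EXIT — corrected: there is a cut radius `S : ℝ → ℝ` with `S τ → ∞` and
`τ − S τ → ∞` such that for every late chart time `τ` the cut of `𝓘⁺` generated by the flat
chart's ball slab `K₀ τ = Ψ₀ '' (Minkowski.backgroundOn U₀).truncTimeSlab (S τ) τ`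
(`= Ψ₀ '' {x ∈ U₀ | x⁰ = τ, |x̲| ≤ S τ}`; the excised tubes are not in `U₀`, their outgoing
light cannot overtake the outer front, so the cone near `𝓘⁺` is the smooth outgoing front of the
sphere `|x̲| = S τ`) has a Bondi energy (`HasCutBondiMass`), and the rest masses
`cutBondiMass (K₀ τ)` are bounded below by and converge to a final value `μ`.
[cite: ChruscielEtAl2001, Thm. 1.1] [cite: ChristodoulouKlainerman1993PMS41, Ch. 17, Conclusion 17.0.4] -/
def PinnedExitsFlatCut (𝒟 : VacuumCauchyDevelopment D) {N : ℕ} (M a : Fin N → ℝ)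
    (mo : Fin N → lorentzGroup × E4) (τ₀ : ℝ)
    (Ψ : ∀ i, boostedKerrExterior (mo i).1 (mo i).2 (M i) (a i) → 𝒟.carrier)
    (R : Fin N → ℝ → ℝ) (U₀ : Opens E4) (Ψ₀ : U₀ → 𝒟.carrier) : Prop :=
  let C : Set 𝒟.carrier :=
    (⋃ i, Ψ i '' (boostedKerrBackground (mo i).1 (mo i).2 (M i) (a i)).lateRegion τ₀) ∪
      Ψ₀ '' (Minkowski.backgroundOn U₀).lateRegion τ₀
  (∃ (H : EventHorizonArea 𝒟.toCauchyDevelopment C) (A : ℝ≥0∞), A ≠ ⊤ ∧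
    (∀ w : ℝ, ∀ᶠ v in atTop, ∀ i, Disjoint
      (Set.range (H.leaf w) ∩ 𝒟.toCauchyDevelopment.eventHorizon C)
      (𝒟.metric.chronologicalFuture 𝒟.timeOrientation (Ψ i ''
        (boostedKerrBackground (mo i).1 (mo i).2 (M i) (a i)).truncTimeSlab (R i v) v))) ∧
    (∀ v, H.horizonArea v ≤ A) ∧ Tendsto H.horizonArea atTop (𝓝 A)) ∧
  ∃ S : ℝ → ℝ, Tendsto S atTop atTop ∧ Tendsto (fun τ ↦ τ - S τ) atTop atTop ∧
    (∀ τ : ℝ, τ₀ < τ → ∃ m : ℝ, 𝒟.toCauchyDevelopment.HasCutBondiMass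
      (Ψ₀ '' (Minkowski.backgroundOn U₀).truncTimeSlab (S τ) τ) m) ∧
    ∃ μ : ℝ, (∀ τ : ℝ, τ₀ < τ → μ ≤ 𝒟.toCauchyDevelopment.cutBondiMass
      (Ψ₀ '' (Minkowski.backgroundOn U₀).truncTimeSlab (S τ) τ)) ∧
      Tendsto (fun τ ↦ 𝒟.toCauchyDevelopment.cutBondiMass
        (Ψ₀ '' (Minkowski.backgroundOn U₀).truncTimeSlab (S τ) τ)) atTop (𝓝 μ)

/-- **The null-infinity budget of the corrected waypoint** (read-back used by the capture step
S3a): under `PinnedExitsFlatCut` there are a cut radius `S` and a final value `μ` such that the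
rest mass still to be radiated after chart time `τ`, `cutBondiMass (K₀ τ) − μ`, is nonnegative at
every late time and tends to `0` — "no flux left" at the `𝓘⁺` exit, with NO rate. [folklore] -/
theorem pinnedExitsFlatCut_bondiBudget (𝒟 : VacuumCauchyDevelopment D) {N : ℕ} (M a : Fin N → ℝ)
    (mo : Fin N → lorentzGroup × E4) (τ₀ : ℝ)
    (Ψ : ∀ i, boostedKerrExterior (mo i).1 (mo i).2 (M i) (a i) → 𝒟.carrier)
    (R : Fin N → ℝ → ℝ) (U₀ : Opens E4) (Ψ₀ : U₀ → 𝒟.carrier)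
    (h : PinnedExitsFlatCut 𝒟 M a mo τ₀ Ψ R U₀ Ψ₀) :
    ∃ (S : ℝ → ℝ) (μ : ℝ), Tendsto S atTop atTop ∧ Tendsto (fun τ ↦ τ - S τ) atTop atTop ∧
      (∀ τ : ℝ, τ₀ < τ → 0 ≤ 𝒟.toCauchyDevelopment.cutBondiMass
        (Ψ₀ '' (Minkowski.backgroundOn U₀).truncTimeSlab (S τ) τ) - μ) ∧
      Tendsto (fun τ ↦ 𝒟.toCauchyDevelopment.cutBondiMass
        (Ψ₀ '' (Minkowski.backgroundOn U₀).truncTimeSlab (S τ) τ) - μ) atTop (𝓝 0) := by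
  obtain ⟨-, S, hS, hτS, -, μ, hμ, hlim⟩ := h
  refine ⟨S, μ, hS, hτS, fun τ hτ ↦ sub_nonneg.2 (hμ τ hτ), ?_⟩
  simpa using hlim.sub_const μ

end Reshape1

end Summit.FinalStateConjecture.FinalStateConjecture.Theorems.ClusterCompleteness

end
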